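import Literature.Probability.RandomPlanarGeometry.HexSAWStripSurfaceArchRadius
import HarnessLib

/-!
# Side exits become BRIDGES one column further: `B_{T,L}(x_c;y) + x_c^{2T} · y · E_{T,L}(x_c;y) ≤ B_{T,L+1}(x_c;y)`,
# hence a FLOOR on the side class forces LINEAR growth of the critical bridge class of the DCS strip

Topic `Literature/Probability/RandomPlanarGeometry` (lane «pcv-sawmu», a-p2 g14; the UPWARD twin of `HexSAWStripSurfaceArchRadius.lean`
(a-p2 g11), whose surgery `HV.epsToArch` continues an `ε`-walk of `S_{T,L}` DOWN the boundary column beyond its cut into an arch of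
`S_{T,L+1}`; here the walk is continued UP the same column to the top level `2T − 1` and out through the `β` mid-edge above it, giving
a BRIDGE of `S_{T,L+1}` with exactly ONE more surface contact.  Uses `HV.exitX`, `HV.exitSide`, `HV.exitRow`, `HV.eps_exit_eq`,
`HV.not_mem_stripV_of_mem_exitTail`'s coordinates, `HV.eps_anatomy` / `HV.eps_exit_unique` (`HexSAWStripEpsWalks.lean`), the strip classes
`HV.stripGFy T L cls y` (`HexSAWStripSurfaceArchCut.lean`) and `HV.stripGFy_beta_mono_L` (`HexSAWStripSurfaceLimits.lean`)).
Sources: H. Duminil-Copin, S. Smirnov, *The connective constant of the honeycomb lattice equals `√(2+√2)`*, Ann. of Math. 175 (2012),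
arXiv:1007.0575v2, §3 (the domain `S_{T,L}` with boundary parts `α`, `β`, `ε`, `ε̄`, Fig. 3 — printed there with `α` LEFT, `β` RIGHT and the
cuts `ε`, `ε̄` top/bottom; this file uses the rotated picture of BBdGDCG14 §4.1: `α` = bottom, `β` = top, `ε`, `ε̄` = the lateral cuts);
N. R. Beaton, M. Bousquet-Mélou, J. de Gier, H. Duminil-Copin, A. J. Guttmann, Comm. Math. Phys. 326 (2014), arXiv:1109.0358v5, §4.1
identity (16) and Corollary 8 (p. 12: `y_T` is the common radius of `A_T(x_c;·)`, `B_T(x_c;·)`).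

MOTIVATION (the lane's crux note `CRUX-NOTE-linear-divergence.md`, a-p2 g13, route (R2)): at the strip threshold `y_T` the lane knows
`B_{T,N}(x_c; y_T) ≳ √N` (banked «THRESHOLD+») and conjectures LINEAR growth `B_{T,N}(x_c;y_T) ≍ N` (exact for `T = 1, 2` in the tree).
This file proves the bookkeeping half of (R2): every side exit of `S_{T,L}` re-enters the count as a bridge of `S_{T,L+1}` that is NOT a
bridge of `S_{T,L}`, so `B_{T,L+1} − B_{T,L} ≥ x_c^{2T} y · E_{T,L}`, and therefore a uniform floor `E_{T,L}(x_c;y) ≥ e > 0` (all `L < N`)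
gives `B_{T,N}(x_c;y) ≥ B_{T,0}(x_c;y) + x_c^{2T} y e · N`.  The floor itself at `y = y_T` ("no decay of the side class AT the threshold")
is the open analytic half and is NOT proved here.

## What is proved (namespace `Literature.Probability.RandomPlanarGeometry.SAW.HV`; `T ≥ 1`, `y ≥ 0`; standard axioms)

* the ascending boundary column `upCol`, `upTail`, the outer endpoint `topEnd` of the `β` mid-edge above it, and the surgery
  `epsToBridge T L P`; its anatomy (`epsToBridge_spec`), ★ `epsToBridge_mem` (a bridge of `S_{T,L+1}`),
  `surfContacts_epsToBridge` (contacts `+ 1`: the top vertex of the column), `mwLen_epsToBridge` (`+ (2T − 2m)` vertices, `m` = exit row),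
  `epsToBridge_injOn`, `epsToBridge_not_mem_filter` (not a bridge of `S_{T,L}`);
* ★★ `stripGFy_beta_add_mul_eps_le_beta_succ` — `B_{T,L}(x_c;y) + x_c^{2T} · y · E_{T,L}(x_c;y) ≤ B_{T,L+1}(x_c;y)`;
  `mul_stripGFy_eps_le_beta_succ` (`x_c^{2T} y E_{T,L} ≤ B_{T,L+1}`);
* telescoped: `stripGFy_beta_zero_add_mul_sum_eps_le` (`B_{T,0} + x_c^{2T} y Σ_{L<N} E_{T,L} ≤ B_{T,N}`), `sum_stripGFy_eps_le_beta`
  (`Σ_{L<N} E_{T,L} ≤ (x_c^{2T} y)⁻¹ B_{T,N}`, `y > 0`);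
* ★★ `stripGFy_beta_linear_of_eps_floor` — CRUX (R2), bookkeeping half: `(∀ L < N, e ≤ E_{T,L}(x_c;y)) → B_{T,0}(x_c;y) + x_c^{2T}·y·e·N ≤ B_{T,N}(x_c;y)`.

Label: LANE LEMMA (XS–S), NEW-IN-WRITING (modest): the `ε → β` comparison and its increment form are not in print (BBdGDCG14 compare the
three series through rationality, Cor. 8; DCS12 cut walks at the strip boundary in the OPPOSITE direction, `A_{T+1} − A_T ≤ x_c B_{T+1}²`).
NOT claimed: the floor on `E_{T,L}(x_c; y_T)`, the linear law itself for `T ≥ 3`, anything at `y > y_T`, numerics.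
Lane «pcv-sawmu», a-p2 g14, 2026-08-24.  EDITIONS: ed.2 (a-p2 g15) = ed.1 (3dc3eff8) code verbatim, the DCS12 orientation locator re-worded per
ref g54 §92.24 (S2B-1).
-/

noncomputable section

open Finset Filter Topology

namespace Literature.Probability.RandomPlanarGeometry.SAW.HV

/-! ### The ascending boundary column -/

/-- The boundary column of `S_{T,L+1} ∖ S_{T,L}` listed UPWARDS from the odd vertex of row `j`, through `k` more rows: rows
`j, j+1, …, j+k`, on each row above `j` the even vertex then the odd vertex. [cite: DuminilCopinSmirnov2012, §3 (S_{T,L}, Fig. 3)] -/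
def upCol (r : Bool) (L : ℕ) : ℕ → ℕ → List HV
  | j, 0 => [(exitX r L j true, (j : ℤ), true)]
  | j, k + 1 => (exitX r L j true, (j : ℤ), true) :: (exitX r L ((j + 1 : ℕ) : ℤ) false, ((j + 1 : ℕ) : ℤ), false) :: upCol r L (j + 1) k

/-- The ascending column from the even vertex of row `m` (the exit vertex of an `ε`-dart on row `m`) up through `k` more rows.
[cite: DuminilCopinSmirnov2012, §3 (Fig. 3)] -/
def upTail (r : Bool) (L m k : ℕ) : List HV := (exitX r L m false, (m : ℤ), false) :: upCol r L m k

/-- The outer endpoint of the `β` mid-edge above the odd vertex of row `t` of the column (row `t + 1`). [cite: DuminilCopinSmirnov2012, §3 (β)] -/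
def topEnd (r : Bool) (L t : ℕ) : HV := (exitX r L t true, (t : ℤ) + 1, false)

/-- One step of the recursion. [cite: DuminilCopinSmirnov2012, §3] -/
theorem upCol_succ (r : Bool) (L j k : ℕ) :
    upCol r L j (k + 1) = (exitX r L j true, (j : ℤ), true) :: (exitX r L ((j + 1 : ℕ) : ℤ) false, ((j + 1 : ℕ) : ℤ), false) ::
      upCol r L (j + 1) k := rfl

/-- The column through `k` more rows has `2k + 1` vertices. [cite: DuminilCopinSmirnov2012, §3] -/
theorem length_upCol (r : Bool) (L : ℕ) : ∀ j k : ℕ, (upCol r L j k).length = 2 * k + 1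
  | j, 0 => rfl
  | j, k + 1 => by rw [upCol_succ, List.length_cons, List.length_cons, length_upCol r L (j + 1) k]; ring

/-- `upTail` has `2k + 2` vertices. [cite: DuminilCopinSmirnov2012, §3] -/
theorem length_upTail (r : Bool) (L m k : ℕ) : (upTail r L m k).length = 2 * k + 2 := by
  rw [upTail, List.length_cons, length_upCol]

/-- The column is never empty. [cite: DuminilCopinSmirnov2012, §3] -/
theorem upCol_ne_nil (r : Bool) (L j k : ℕ) : upCol r L j k ≠ [] := by
  cases k <;> exact List.cons_ne_nil _ _

/-- `upTail` is never empty. [cite: DuminilCopinSmirnov2012, §3] -/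
theorem upTail_ne_nil (r : Bool) (L m k : ℕ) : upTail r L m k ≠ [] := List.cons_ne_nil _ _

/-- Coordinates along the ascending column: rows in `[j, j+k]`, levels in `[2j+1, 2(j+k)+1]`, abscissa on the boundary line of `S_{T,L+1}`.
[cite: DuminilCopinSmirnov2012, §3 (Fig. 3)] -/
theorem mem_upCol {r : Bool} {L : ℕ} : ∀ {j k : ℕ} {v : HV}, v ∈ upCol r L j k →
    (j : ℤ) ≤ v.2.1 ∧ v.2.1 ≤ (j : ℤ) + k ∧ 2 * (j : ℤ) + 1 ≤ lev v ∧ lev v ≤ 2 * ((j : ℤ) + k) + 1 ∧ v.1 = exitX r L v.2.1 v.2.2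
  | j, 0, v, hv => by
    simp only [upCol, List.mem_singleton] at hv
    subst hv
    simp only [lev_mk, bit_true]
    exact ⟨le_rfl, by simp, by omega, by push_cast; omega, by trivial⟩
  | j, k + 1, v, hv => by
    rw [upCol_succ] at hv
    rcases List.mem_cons.1 hv with rfl | hv
    · simp only [lev_mk, bit_true]
      exact ⟨le_rfl, by push_cast; omega, by omega, by push_cast; omega, by trivial⟩
    rcases List.mem_cons.1 hv with rfl | hv
    · simp only [lev_mk, bit_false]
      exact ⟨by push_cast; omega, by push_cast; omega, by push_cast; omega, by push_cast; omega, by trivial⟩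
    · obtain ⟨h1, h2, h3, h4, h5⟩ := mem_upCol hv
      exact ⟨by push_cast at h1 ⊢; omega, by push_cast at h2 ⊢; omega, by push_cast at h3 ⊢; omega,
        by push_cast at h4 ⊢; omega, h5⟩

/-- Coordinates along `upTail`: rows in `[m, m+k]`, levels in `[2m, 2(m+k)+1]`, abscissa on the boundary line. [cite: DuminilCopinSmirnov2012, §3 (Fig. 3)] -/
theorem mem_upTail {r : Bool} {L m k : ℕ} {v : HV} (hv : v ∈ upTail r L m k) :
    (m : ℤ) ≤ v.2.1 ∧ v.2.1 ≤ (m : ℤ) + k ∧ 2 * (m : ℤ) ≤ lev v ∧ lev v ≤ 2 * ((m : ℤ) + k) + 1 ∧ v.1 = exitX r L v.2.1 v.2.2 := by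
  rw [upTail] at hv
  rcases List.mem_cons.1 hv with rfl | hv
  · simp only [lev_mk, bit_false]
    exact ⟨le_rfl, by omega, by omega, by omega, by trivial⟩
  · obtain ⟨h1, h2, h3, h4, h5⟩ := mem_upCol hv
    exact ⟨h1, h2, by omega, h4, h5⟩

/-- The last vertex of the column is the odd vertex of its top row `j + k`. [cite: DuminilCopinSmirnov2012, §3] -/
theorem getLast_upCol (r : Bool) (L : ℕ) : ∀ j k : ℕ,
    (upCol r L j k).getLast (upCol_ne_nil r L j k) = (exitX r L ((j + k : ℕ) : ℤ) true, ((j + k : ℕ) : ℤ), true)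
  | j, 0 => by simp [upCol]
  | j, k + 1 => by
    rw [← Option.some_inj, ← List.getLast?_eq_some_getLast, upCol_succ, List.getLast?_cons_cons,
      List.getLast?_cons_of_ne_nil (upCol_ne_nil r L (j + 1) k), List.getLast?_eq_some_getLast (upCol_ne_nil r L (j + 1) k),
      getLast_upCol r L (j + 1) k, show j + 1 + k = j + (k + 1) by ring]

/-- The last vertex of `upTail r L m k` is the odd vertex of row `m + k`. [cite: DuminilCopinSmirnov2012, §3] -/
theorem getLast_upTail (r : Bool) (L m k : ℕ) :
    (upTail r L m k).getLast (upTail_ne_nil r L m k) = (exitX r L ((m + k : ℕ) : ℤ) true, ((m + k : ℕ) : ℤ), true) := by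
  rw [← Option.some_inj, ← List.getLast?_eq_some_getLast, upTail, List.getLast?_cons_of_ne_nil (upCol_ne_nil r L m k),
    List.getLast?_eq_some_getLast (upCol_ne_nil r L m k), getLast_upCol]

/-- The head of `upTail` is the even vertex of row `m`. [cite: DuminilCopinSmirnov2012, §3] -/
theorem head?_upTail (r : Bool) (L m k : ℕ) : (upTail r L m k).head? = some (exitX r L m false, (m : ℤ), false) := rfl

/-- The even vertex of a row is joined to the odd vertex of the same row on the column. [cite: DuminilCopinSmirnov2012, §3 (every edge joins consecutive levels)] -/
theorem adj_even_odd (r : Bool) (L : ℕ) (j : ℤ) : hvGraph.Adj (exitX r L j false, j, false) (exitX r L j true, j, true) := by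
  cases r <;> simp [hvGraph_adj, AdjRel, exitX]

/-- The odd vertex of row `j` is joined to the even vertex of row `j + 1` on the column. [cite: DuminilCopinSmirnov2012, §3] -/
theorem adj_odd_even_succ (r : Bool) (L : ℕ) (j : ℤ) :
    hvGraph.Adj (exitX r L j true, j, true) (exitX r L (j + 1) false, j + 1, false) := by
  cases r
  · simp [hvGraph_adj, AdjRel, exitX]; ring
  · simp [hvGraph_adj, AdjRel, exitX]

/-- The ascending column is a path of `ℍ`. [cite: DuminilCopinSmirnov2012, §3] -/
theorem isChain_upCol (r : Bool) (L : ℕ) : ∀ j k : ℕ, (upCol r L j k).IsChain hvGraph.Adj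
  | j, 0 => List.isChain_singleton _
  | j, k + 1 => by
    rw [upCol_succ]
    refine List.IsChain.cons_cons (by simpa using adj_odd_even_succ r L (j : ℤ)) ?_
    cases k with
    | zero => exact List.IsChain.cons_cons (by simpa using adj_even_odd r L ((j : ℤ) + 1)) (List.isChain_singleton _)
    | succ k =>
      rw [upCol_succ]
      refine List.IsChain.cons_cons (by simpa using adj_even_odd r L ((j : ℤ) + 1)) ?_
      have := isChain_upCol r L (j + 1) (k + 1)
      rwa [upCol_succ] at this

/-- `upTail` is a path of `ℍ`. [cite: DuminilCopinSmirnov2012, §3] -/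
theorem isChain_upTail (r : Bool) (L m k : ℕ) : (upTail r L m k).IsChain hvGraph.Adj := by
  rw [upTail]
  cases k with
  | zero => exact List.IsChain.cons_cons (adj_even_odd r L m) (List.isChain_singleton _)
  | succ k =>
    rw [upCol_succ]
    refine List.IsChain.cons_cons (adj_even_odd r L m) ?_
    have := isChain_upCol r L m (k + 1)
    rwa [upCol_succ] at this

/-- The ascending column is self-avoiding (its levels strictly increase). [cite: DuminilCopinSmirnov2012, §3] -/
theorem nodup_upCol (r : Bool) (L : ℕ) : ∀ j k : ℕ, (upCol r L j k).Nodup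
  | j, 0 => List.nodup_singleton _
  | j, k + 1 => by
    rw [upCol_succ, List.nodup_cons, List.nodup_cons]
    refine ⟨fun h => ?_, fun h => ?_, nodup_upCol r L (j + 1) k⟩
    · rcases List.mem_cons.1 h with h | h
      · simp at h
      · have := (mem_upCol h).2.2.1; simp only [lev_mk, bit_true] at this; push_cast at this; omega
    · have := (mem_upCol h).2.2.1; simp only [lev_mk, bit_false] at this; push_cast at this; omega

/-- `upTail` is self-avoiding. [cite: DuminilCopinSmirnov2012, §3] -/
theorem nodup_upTail (r : Bool) (L m k : ℕ) : (upTail r L m k).Nodup := by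
  rw [upTail, List.nodup_cons]
  refine ⟨fun h => ?_, nodup_upCol r L m k⟩
  have := (mem_upCol h).2.2.1; simp only [lev_mk, bit_false] at this; omega

/-- The top vertex of `upTail` is joined to the outer endpoint of the `β` mid-edge above it. [cite: DuminilCopinSmirnov2012, §3 (β)] -/
theorem adj_getLast_upTail_topEnd (r : Bool) (L m k : ℕ) :
    hvGraph.Adj ((upTail r L m k).getLast (upTail_ne_nil r L m k)) (topEnd r L (m + k)) := by
  rw [getLast_upTail]
  cases r <;> simp [hvGraph_adj, AdjRel, exitX, topEnd]

/-- The column lies outside `S_{T,L}` (its abscissa is on the boundary line of `S_{T,L+1}`). [cite: DuminilCopinSmirnov2012, §3 (S_{T,L})] -/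
theorem not_mem_stripV_of_mem_upTail {r : Bool} {T L m k : ℕ} {v : HV} (hv : v ∈ upTail r L m k) : v ∉ stripV T L := by
  obtain ⟨h1, -, -, -, h5⟩ := mem_upTail hv
  obtain ⟨a, b, c⟩ := v
  simp only at h1 h5
  rw [mem_stripV_iff]
  subst h5
  cases r <;> cases c <;> simp [exitX, bit]

/-- The column lies inside `S_{T,L+1}` as soon as its top row is `≤ T − 1`. [cite: DuminilCopinSmirnov2012, §3 (S_{T,L})] -/
theorem mem_stripV_succ_of_mem_upTail {r : Bool} {T L m k : ℕ} (hmk : m + k + 1 ≤ T) {v : HV} (hv : v ∈ upTail r L m k) :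
    v ∈ stripV T (L + 1) := by
  obtain ⟨h1, h2, h3, h4, h5⟩ := mem_upTail hv
  obtain ⟨a, b, c⟩ := v
  simp only at h1 h2 h5
  rw [mem_stripV_iff]
  subst h5
  simp only [lev_mk] at h3 h4 ⊢
  cases r <;> cases c <;> simp [exitX, bit] at h3 h4 ⊢ <;> omega

/-- The contacts on the column: exactly the top vertex is at the top level `2(m+k) + 1`. [cite: BeatonBousquetMelouDeGierDuminilCopinGuttmann2014, §2 (arXiv v5 p. 4: c(γ), "the number of contacts with the surface")] -/
theorem filter_lev_upCol (r : Bool) (L : ℕ) : ∀ j k : ℕ,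
    (upCol r L j k).filter (fun v => lev v = 2 * ((j : ℤ) + k) + 1) = [(exitX r L ((j + k : ℕ) : ℤ) true, ((j + k : ℕ) : ℤ), true)]
  | j, 0 => by simp [upCol, lev_mk, bit_true]
  | j, k + 1 => by
    rw [upCol_succ, List.filter_cons_of_neg, List.filter_cons_of_neg]
    · have := filter_lev_upCol r L (j + 1) k
      have e : 2 * (((j + 1 : ℕ) : ℤ) + k) + 1 = 2 * ((j : ℤ) + ((k + 1 : ℕ) : ℤ)) + 1 := by push_cast; ring
      rw [e] at this
      rw [this, show j + 1 + k = j + (k + 1) by ring]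
    · simp only [lev_mk, bit_false, decide_eq_true_eq]; push_cast; omega
    · simp only [lev_mk, bit_true, decide_eq_true_eq]; push_cast; omega

/-- The contacts on `upTail`: exactly one vertex at level `2(m+k) + 1`. [cite: BeatonBousquetMelouDeGierDuminilCopinGuttmann2014, §2 (arXiv v5 p. 4)] -/
theorem length_filter_lev_upTail (r : Bool) (L m k : ℕ) :
    ((upTail r L m k).filter fun v => lev v = 2 * ((m : ℤ) + k) + 1).length = 1 := by
  rw [upTail, List.filter_cons_of_neg, filter_lev_upCol, List.length_singleton]
  simp only [lev_mk, bit_false, decide_eq_true_eq]; omega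

/-! ### The surgery on an `ε`-walk: up the column and out through `β` -/

/-- **The surgery**: continue an `ε`-walk of `S_{T,L}` up the boundary column beyond its cut to the top level and out through the `β`
mid-edge above. [cite: BeatonBousquetMelouDeGierDuminilCopinGuttmann2014, Corollary 8 (arXiv v5 p. 12: the common radius of B_T and the other series); lane: the injection ε-walks → bridges] -/
def epsToBridge (T L : ℕ) (P : List HV) : List HV :=
  wOut :: ((inner P ++ upTail (exitSide L P) L (exitRow P) (T - 1 - exitRow P)) ++ [topEnd (exitSide L P) L (T - 1)])

variable {T L : ℕ}

/-- Anatomy of the surgery on an `ε`-walk `w :: (l ++ [u])`: the result is `w :: ((l ++ column) ++ [top end])`, the column starting at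
`u` on row `m` and climbing `k = T − 1 − m` rows. [cite: BeatonBousquetMelouDeGierDuminilCopinGuttmann2014, Corollary 8 (arXiv v5 p. 12); lane] -/
theorem epsToBridge_spec (hT : 1 ≤ T) {P : List HV} (hP : P ∈ epsWalks T L) :
    ∃ (l : List HV) (hl : l ≠ []) (r : Bool) (m k : ℕ), P = wOut :: (l ++ [(exitX r L m false, (m : ℤ), false)]) ∧
      epsToBridge T L P = wOut :: ((l ++ upTail r L m k) ++ [topEnd r L (m + k)]) ∧ l.IsChain hvGraph.Adj ∧ l.head? = some hvOrigin ∧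
      l.Nodup ∧ (∀ x ∈ l, x ∈ stripV T L) ∧ m + k + 1 = T ∧
      hvGraph.Adj (l.getLast hl) (exitX r L m false, (m : ℤ), false) := by
  have hT' := hT
  obtain ⟨l, u, hl, rfl, hc, hh, hnd, hV, hε, -⟩ := eps_anatomy hP
  have hz := hV _ (List.getLast_mem hl)
  have hz0 : 0 ≤ (l.getLast hl).2.1 := (mem_stripV_iff.1 hz).1
  have hu := eps_exit_eq hz0 hε
  set r := decide ((l.getLast hl).1 = (L : ℤ))
  set m := (l.getLast hl).2.1.toNat
  have hadj : hvGraph.Adj (l.getLast hl) u :=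
    ((isMidWalk_cons_append_iff _ hl u).1 (mem_midWalks_iff.1 (mem_filter.1 hP).1)).2.2.1
  -- the exit row `m` satisfies `m + 1 ≤ T`
  have hmT : m + 1 ≤ T := by
    have hlev := (mem_stripV_iff.1 hz).2.1
    have hbit : bit (l.getLast hl) = 1 := by
      obtain ⟨hc1, -⟩ := hε; unfold bit; simp only at hc1; simp [hc1]
    have hm : ((m : ℕ) : ℤ) = (l.getLast hl).2.1 := Int.toNat_of_nonneg hz0
    unfold lev at hlev
    omega
  refine ⟨l, hl, r, m, T - 1 - m, by rw [hu], ?_, hc, hh, hnd, hV, by omega, by rw [← hu]; exact hadj⟩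
  have hside : exitSide L (wOut :: (l ++ [u])) = r := by rw [exitSide, finalDart_cons_append hl]
  have hrow : exitRow (wOut :: (l ++ [u])) = m := by rw [exitRow, finalDart_cons_append hl]
  rw [epsToBridge, inner_cons_append, hside, hrow, show m + (T - 1 - m) = T - 1 by omega]

/-- ★ **The surgery lands in the bridges of `S_{T,L+1}`.** [cite: BeatonBousquetMelouDeGierDuminilCopinGuttmann2014, Corollary 8 (arXiv v5 p. 12); DuminilCopinSmirnov2012, §3 (β); lane: the injection ε-walks → bridges] -/
theorem epsToBridge_mem (hT : 1 ≤ T) {P : List HV} (hP : P ∈ epsWalks T L) :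
    epsToBridge T L P ∈ (midWalks (stripV T (L + 1))).filter fun Q => IsBetaDart T (finalDart Q) := by
  obtain ⟨l, hl, r, m, k, rfl, hmap, hc, hh, hnd, hV, hmk, hadj⟩ := epsToBridge_spec hT hP
  have hne : l ++ upTail r L m k ≠ [] := by simp [hl]
  have hlast : (l ++ upTail r L m k).getLast hne = (exitX r L ((m + k : ℕ) : ℤ) true, ((m + k : ℕ) : ℤ), true) := by
    rw [← Option.some_inj, ← List.getLast?_eq_some_getLast, List.getLast?_append,
      List.getLast?_eq_some_getLast (upTail_ne_nil r L m k), getLast_upTail]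
    rfl
  rw [hmap, mem_filter, mem_midWalks_iff, isMidWalk_cons_append_iff _ hne, finalDart_cons_append hne, hlast]
  refine ⟨⟨?_, ?_, ?_, ?_, ?_, ?_⟩, ?_⟩
  · -- chain
    refine List.IsChain.append hc (isChain_upTail r L m k) fun x hx y hy => ?_
    rw [List.getLast?_eq_some_getLast hl, Option.mem_def, Option.some_inj] at hx
    rw [head?_upTail, Option.mem_def, Option.some_inj] at hy
    subst hx; subst hy; exact hadj
  · rw [List.head?_append_of_ne_nil _ hl, hh]
  · have h := adj_getLast_upTail_topEnd r L m k
    rwa [getLast_upTail] at h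
  · intro x hx
    rcases List.mem_append.1 hx with hx | hx
    · exact stripV_mono_L (Nat.le_succ L) (hV x hx)
    · exact mem_stripV_succ_of_mem_upTail (by omega) hx
  · refine List.Nodup.append hnd (nodup_upTail r L m k) fun x hx hx' => ?_
    exact not_mem_stripV_of_mem_upTail hx' (hV x hx)
  · -- no retracing: the previous vertex is `w` (row −1) or has row ≤ m + k = T − 1, the end has row T
    intro heq
    rcases prevOf_mem (l ++ upTail r L m k) with h | h
    · rw [← heq] at h
      have := congrArg (fun v : HV => v.2.1) h
      simp [topEnd, wOut] at this
      omega
    · rw [← heq] at h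
      rcases List.mem_append.1 h with h | h
      · have h1 := (mem_stripV_iff.1 (hV _ h)).2.1
        simp only [topEnd, lev_mk, bit_false] at h1
        push_cast at h1
        omega
      · have h1 := (mem_upTail h).2.1
        simp only [topEnd] at h1
        push_cast at h1
        omega
  · refine ⟨by push_cast; omega, rfl, ?_⟩
    simp [topEnd]

/-- **The surgery adds exactly ONE surface contact** (the top vertex of the column, at level `2T − 1`).
[cite: BeatonBousquetMelouDeGierDuminilCopinGuttmann2014, §2 (arXiv v5 p. 4: c(γ)); lane] -/
theorem surfContacts_epsToBridge (hT : 1 ≤ T) {P : List HV} (hP : P ∈ epsWalks T L) :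
    surfContacts T (epsToBridge T L P) = surfContacts T P + 1 := by
  obtain ⟨l, hl, r, m, k, rfl, hmap, -, -, -, -, hmk, -⟩ := epsToBridge_spec hT hP
  rw [hmap, surfContacts_cons_append, surfContacts_cons_append, List.filter_append, List.length_append]
  have e : 2 * (T : ℤ) - 1 = 2 * ((m : ℤ) + k) + 1 := by push_cast [← hmk]; ring
  rw [e, length_filter_lev_upTail]

/-- **The surgery adds `2(T − m)` vertices** (`m` = the exit row, `m + 1 ≤ T`). [cite: DuminilCopinSmirnov2012, §1 (ℓ(γ)); lane] -/
theorem mwLen_epsToBridge (hT : 1 ≤ T) {P : List HV} (hP : P ∈ epsWalks T L) :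
    ∃ m : ℕ, m + 1 ≤ T ∧ mwLen (epsToBridge T L P) = mwLen P + (2 * (T - m)) := by
  obtain ⟨l, hl, r, m, k, rfl, hmap, -, -, -, -, hmk, -⟩ := epsToBridge_spec hT hP
  refine ⟨m, by omega, ?_⟩
  rw [hmap, mwLen_cons_append, mwLen_cons_append, List.length_append, length_upTail]
  omega

/-- **The surgery is injective on the `ε`-walks of `S_{T,L}`.** [cite: DuminilCopinSmirnov2012, §3 (ε, ε̄); lane] -/
theorem epsToBridge_injOn (hT : 1 ≤ T) : Set.InjOn (epsToBridge T L) (epsWalks T L : Set (List HV)) := by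
  classical
  intro P₁ hP₁ P₂ hP₂ heq
  obtain ⟨l₁, hl₁, r₁, m₁, k₁, rfl, hmap₁, -, -, -, hV₁, -, -⟩ := epsToBridge_spec hT (mem_coe.1 hP₁)
  obtain ⟨l₂, hl₂, r₂, m₂, k₂, rfl, hmap₂, -, -, -, hV₂, -, -⟩ := epsToBridge_spec hT (mem_coe.1 hP₂)
  have key : ∀ (l : List HV) (r : Bool) (m k : ℕ), (∀ x ∈ l, x ∈ stripV T L) →
      ((l ++ upTail r L m k) ++ [topEnd r L (m + k)]).filter (fun v => decide (v ∈ stripV T L)) = l := by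
    intro l r m k hV
    rw [List.filter_append, List.filter_append, List.filter_eq_self.2 (by simpa using hV),
      (List.filter_eq_nil_iff).2 (fun v hv => by simpa using not_mem_stripV_of_mem_upTail (T := T) hv),
      (List.filter_eq_nil_iff).2 (fun v hv => ?_)]
    · simp
    · rw [List.mem_singleton] at hv; subst hv
      simp only [decide_eq_true_eq, mem_stripV_iff, topEnd]
      cases r
      · simp [exitX, bit]; omega
      · simp [exitX, bit]
  rw [hmap₁, hmap₂] at heq
  have htl := List.tail_eq_of_cons_eq heq
  have hl : l₁ = l₂ := by rw [← key l₁ r₁ m₁ k₁ hV₁, ← key l₂ r₂ m₂ k₂ hV₂, htl]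
  subst hl
  have hε₁ := (mem_filter.1 (mem_coe.1 hP₁)).2
  have hε₂ := (mem_filter.1 (mem_coe.1 hP₂)).2
  rw [finalDart_cons_append hl₁] at hε₁ hε₂
  have hz0 : 0 ≤ (l₁.getLast hl₁).2.1 := (mem_stripV_iff.1 (hV₁ _ (List.getLast_mem hl₁))).1
  rw [eps_exit_unique hz0 hε₁ hε₂]

/-- A surgered side exit is NOT a bridge of `S_{T,L}`: its inner list contains the exit vertex, outside `S_{T,L}`.
[cite: DuminilCopinSmirnov2012, §3 (S_{T,L}); lane] -/
theorem epsToBridge_not_mem_filter (hT : 1 ≤ T) {P : List HV} (hP : P ∈ epsWalks T L) :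
    epsToBridge T L P ∉ (midWalks (stripV T L)).filter fun Q => IsBetaDart T (finalDart Q) := by
  obtain ⟨l, hl, r, m, k, -, hmap, -, -, -, -, -, -⟩ := epsToBridge_spec hT hP
  intro hmem
  have hV := (mem_midWalks_iff.1 (mem_filter.1 hmem).1).2.2.2.1
  rw [hmap, inner_cons_append] at hV
  have hu : (exitX r L m false, ((m : ℕ) : ℤ), false) ∈ upTail r L m k := by rw [upTail]; exact List.mem_cons_self
  exact not_mem_stripV_of_mem_upTail (T := T) hu (hV _ (List.mem_append_right _ hu))

/-! ### `B_{T,L}(x_c;y) + x_c^{2T} · y · E_{T,L}(x_c;y) ≤ B_{T,L+1}(x_c;y)` -/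

variable {y : ℝ}

/-- ★★ **`B_{T,L}(x_c;y) + x_c^{2T} · y · E_{T,L}(x_c;y) ≤ B_{T,L+1}(x_c;y)`** (`T ≥ 1`, `y ≥ 0`): the bridges of `S_{T,L}` and the surgered
side exits of `S_{T,L}` are two DISJOINT sub-families of the bridges of `S_{T,L+1}`; the surgery costs at most `2T` vertices and adds
one contact. [cite: BeatonBousquetMelouDeGierDuminilCopinGuttmann2014, Corollary 8 (arXiv v5 p. 12) and §4.2 (p. 14: the classes increase with L); lane: ε→β comparison, not in print] -/
theorem stripGFy_beta_add_mul_eps_le_beta_succ (hT : 1 ≤ T) (L : ℕ) (hy : 0 ≤ y) :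
    stripGFy T L (IsBetaDart T) y + hexCriticalFugacity ^ (2 * T) * y * stripGFy T L (IsEpsDart L) y ≤
      stripGFy T (L + 1) (IsBetaDart T) y := by
  classical
  obtain ⟨hx0, hx1⟩ := hexCriticalFugacity_pos_lt_one
  set S₁ := (midWalks (stripV T L)).filter fun Q => IsBetaDart T (finalDart Q) with hS₁
  set S₂ := (epsWalks T L).image (epsToBridge T L) with hS₂
  set w : List HV → ℝ := fun Q => hexCriticalFugacity ^ mwLen Q * y ^ surfContacts T Q with hw
  have hsub₁ : S₁ ⊆ (midWalks (stripV T (L + 1))).filter fun Q => IsBetaDart T (finalDart Q) :=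
    filter_subset_filter _ (midWalks_mono (stripV_mono_L (Nat.le_succ L)))
  have hsub₂ : S₂ ⊆ (midWalks (stripV T (L + 1))).filter fun Q => IsBetaDart T (finalDart Q) := by
    intro Q hQ
    obtain ⟨P, hP, rfl⟩ := mem_image.1 hQ
    exact epsToBridge_mem hT hP
  have hdisj : Disjoint S₁ S₂ := by
    rw [Finset.disjoint_left]
    intro Q hQ₁ hQ₂
    obtain ⟨P, hP, rfl⟩ := mem_image.1 hQ₂
    exact epsToBridge_not_mem_filter hT hP hQ₁
  have hB : stripGFy T L (IsBetaDart T) y = ∑ Q ∈ S₁, w Q := rfl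
  have hE : hexCriticalFugacity ^ (2 * T) * y * stripGFy T L (IsEpsDart L) y ≤ ∑ Q ∈ S₂, w Q := by
    calc hexCriticalFugacity ^ (2 * T) * y * stripGFy T L (IsEpsDart L) y
        = ∑ P ∈ epsWalks T L, hexCriticalFugacity ^ (2 * T) * y * (hexCriticalFugacity ^ mwLen P * y ^ surfContacts T P) := by
          rw [stripGFy_eps_eq, mul_sum]
      _ ≤ ∑ P ∈ epsWalks T L, w (epsToBridge T L P) := by
          refine sum_le_sum fun P hP => ?_
          obtain ⟨m, hmT, hlen⟩ := mwLen_epsToBridge hT hP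
          simp only [hw]
          rw [surfContacts_epsToBridge hT hP, hlen, pow_add, pow_succ]
          have hxp : hexCriticalFugacity ^ (2 * T) ≤ hexCriticalFugacity ^ (2 * (T - m)) :=
            pow_le_pow_of_le_one hx0.le hx1.le (by omega)
          have h1 : 0 ≤ hexCriticalFugacity ^ mwLen P * y ^ surfContacts T P := mul_nonneg (pow_nonneg hx0.le _) (pow_nonneg hy _)
          calc hexCriticalFugacity ^ (2 * T) * y * (hexCriticalFugacity ^ mwLen P * y ^ surfContacts T P)
              ≤ hexCriticalFugacity ^ (2 * (T - m)) * y * (hexCriticalFugacity ^ mwLen P * y ^ surfContacts T P) :=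
                mul_le_mul_of_nonneg_right (mul_le_mul_of_nonneg_right hxp hy) h1
            _ = hexCriticalFugacity ^ mwLen P * hexCriticalFugacity ^ (2 * (T - m)) * (y ^ surfContacts T P * y) := by ring
      _ = ∑ Q ∈ S₂, w Q := by rw [hS₂, sum_image (epsToBridge_injOn hT)]
  calc stripGFy T L (IsBetaDart T) y + hexCriticalFugacity ^ (2 * T) * y * stripGFy T L (IsEpsDart L) y
      ≤ ∑ Q ∈ S₁, w Q + ∑ Q ∈ S₂, w Q := by rw [hB]; exact add_le_add le_rfl hE
    _ = ∑ Q ∈ S₁ ∪ S₂, w Q := (sum_union hdisj).symm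
    _ ≤ stripGFy T (L + 1) (IsBetaDart T) y :=
        sum_le_sum_of_subset_of_nonneg (union_subset hsub₁ hsub₂) fun _ _ _ =>
          mul_nonneg (pow_nonneg hx0.le _) (pow_nonneg hy _)

/-- `x_c^{2T} · y · E_{T,L}(x_c;y) ≤ B_{T,L+1}(x_c;y)`. [cite: BeatonBousquetMelouDeGierDuminilCopinGuttmann2014, Corollary 8 (arXiv v5 p. 12); lane] -/
theorem mul_stripGFy_eps_le_beta_succ (hT : 1 ≤ T) (L : ℕ) (hy : 0 ≤ y) :
    hexCriticalFugacity ^ (2 * T) * y * stripGFy T L (IsEpsDart L) y ≤ stripGFy T (L + 1) (IsBetaDart T) y := by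
  linarith [stripGFy_beta_add_mul_eps_le_beta_succ hT L hy, stripGFy_nonneg' T L (IsBetaDart T) hy]

/-! ### Telescoping and the bookkeeping half of CRUX (R2) -/

/-- `B_{T,0}(x_c;y) + x_c^{2T} · y · Σ_{L<N} E_{T,L}(x_c;y) ≤ B_{T,N}(x_c;y)`. [cite: BeatonBousquetMelouDeGierDuminilCopinGuttmann2014, §4.2 (arXiv v5 p. 14); lane] -/
theorem stripGFy_beta_zero_add_mul_sum_eps_le (hT : 1 ≤ T) (N : ℕ) (hy : 0 ≤ y) :
    stripGFy T 0 (IsBetaDart T) y + hexCriticalFugacity ^ (2 * T) * y * ∑ L ∈ Finset.range N, stripGFy T L (IsEpsDart L) y ≤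
      stripGFy T N (IsBetaDart T) y := by
  induction N with
  | zero => simp
  | succ N ih =>
    rw [sum_range_succ, mul_add, ← add_assoc]
    linarith [stripGFy_beta_add_mul_eps_le_beta_succ hT N hy]

/-- **`Σ_{L<N} E_{T,L}(x_c;y) ≤ (x_c^{2T} · y)⁻¹ · B_{T,N}(x_c;y)`** for `y > 0`: the side class's partial sums are dominated by the
bridge class (so `y ∈ stripBddSet T` gives `Σ_L E_{T,L} < ∞` directly from the bridges).
[cite: BeatonBousquetMelouDeGierDuminilCopinGuttmann2014, proof of Proposition 9 (§4.3, arXiv v5 p. 14); lane] -/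
theorem sum_stripGFy_eps_le_beta (hT : 1 ≤ T) (N : ℕ) (hy : 0 < y) :
    ∑ L ∈ Finset.range N, stripGFy T L (IsEpsDart L) y ≤
      (hexCriticalFugacity ^ (2 * T) * y)⁻¹ * stripGFy T N (IsBetaDart T) y := by
  have hx := mul_pos (pow_pos hexCriticalFugacity_pos_lt_one.1 (2 * T)) hy
  rw [le_inv_mul_iff₀ hx]
  linarith [stripGFy_beta_zero_add_mul_sum_eps_le hT N hy.le, stripGFy_nonneg' T 0 (IsBetaDart T) hy.le]

/-- ★★ **CRUX (R2), bookkeeping half: a FLOOR on the side class forces LINEAR growth of the bridge class.**  If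
`e ≤ E_{T,L}(x_c;y)` for all `L < N` then `B_{T,0}(x_c;y) + x_c^{2T} · y · e · N ≤ B_{T,N}(x_c;y)` (`T ≥ 1`, `y ≥ 0`).  At `y = y_T` a
positive floor (conjectured in the lane's CRUX-NOTE, true for `T = 1` where `E_{1,L}(x_c;y_1) = 2`, tree `HexSAWStripSurfaceWidthOneProfile`)
would give the linear law `B_{T,N}(x_c;y_T) ≍ N`. [cite: BeatonBousquetMelouDeGierDuminilCopinGuttmann2014, Corollary 8 (arXiv v5 p. 12: y_T the radius of B_T(x_c;·), no rate printed); lane] -/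
theorem stripGFy_beta_linear_of_eps_floor (hT : 1 ≤ T) {N : ℕ} (hy : 0 ≤ y) {e : ℝ}
    (he : ∀ L, L < N → e ≤ stripGFy T L (IsEpsDart L) y) :
    stripGFy T 0 (IsBetaDart T) y + hexCriticalFugacity ^ (2 * T) * y * e * N ≤ stripGFy T N (IsBetaDart T) y := by
  have hx : 0 ≤ hexCriticalFugacity ^ (2 * T) * y := mul_nonneg (pow_nonneg hexCriticalFugacity_pos_lt_one.1.le _) hy
  have hsum : e * N ≤ ∑ L ∈ Finset.range N, stripGFy T L (IsEpsDart L) y := by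
    calc e * N = ∑ L ∈ Finset.range N, e := by rw [sum_const, card_range, nsmul_eq_mul, mul_comm]
      _ ≤ ∑ L ∈ Finset.range N, stripGFy T L (IsEpsDart L) y := sum_le_sum fun L hL => he L (mem_range.1 hL)
  calc stripGFy T 0 (IsBetaDart T) y + hexCriticalFugacity ^ (2 * T) * y * e * N
      = stripGFy T 0 (IsBetaDart T) y + hexCriticalFugacity ^ (2 * T) * y * (e * N) := by ring
    _ ≤ stripGFy T 0 (IsBetaDart T) y + hexCriticalFugacity ^ (2 * T) * y * ∑ L ∈ Finset.range N, stripGFy T L (IsEpsDart L) y :=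
        add_le_add le_rfl (mul_le_mul_of_nonneg_left hsum hx)
    _ ≤ stripGFy T N (IsBetaDart T) y := stripGFy_beta_zero_add_mul_sum_eps_le hT N hy

end Literature.Probability.RandomPlanarGeometry.SAW.HV
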